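/-
[OURS · L1 W4.5(b) · EL♮(3)] SPECIMEN-TC⁺ — the assembly `tcPlusPointResolvable_quartic` (non-vacuity certificate for the registered TC⁺ text).
[claim: Hironaka2017, status: under-review]
-/
import Summits.ResolutionOfSingularities.ResolutionOfSingularities.Theorems.EquisingularLiftEquisingularLiftNatSpecimenQuarticTcPlusThreeStepGlobal
import Summits.ResolutionOfSingularities.ResolutionOfSingularities.Theorems.EquisingularLiftEquisingularLiftNatSpecimenQuarticTcPlusInnerStage
import Summits.ResolutionOfSingularities.ResolutionOfSingularities.Theorems.EquisingularLiftEquisingularLiftNatSpecimenQuarticTcDelta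
import HarnessLib

/-!
# [OURS · L1 W4.5(b) · EL♮(3)] SPECIMEN-TC⁺ — THE ASSEMBLY `tcPlusPointResolvable_quartic`: a NON-VACUITY CERTIFICATE for the registered stub
# `stub_elnat_tcPlusPointResolution` (L/res-L1-w45b-lead-2/TARGET-TCPLUS.lean = SkeletonELnatThree-v8) with a NON-EMPTY inner chain
# (crux `EquisingularLiftNatThree` = stmt-ResolutionOfSingularities-20148; res-L1-w45b-lead-2 DEALS (D2) 2026-08-27T11:55:26Z; helper, closes nothing)

HONEST FRAMING. OURS (cell `res-hironaka`, chain w45b, slot W4.5(b)); NOT a statement of any manuscript; AI-written, weaker than expert review.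
THE THEOREM: the 5th explicit hypothesis («TC⁺ point-resolvable downstairs») of the REGISTERED stub VERBATIM at `n := 3`,
`H := (hypersurface (SpecimenQuartic.form k)).left`, `ι := (hypersurfaceι (SpecimenQuartic.form k)).left` (statement text extracted programmatically
from TARGET-TCPLUS.lean), for `H = V(x₀²x₃² + x₁⁴ + x₂⁴) ⊂ ℙ³_k`, `k = k̄`, `char k = p ≠ 2`. THE WITNESS (memo D/res-D-pv-034/SPECIMEN-TCPLUS-SCOPE.md):
(TC⁺) at `v = [0:0:0:1]`, `W := ι(H)`, base `R F₂ 𝟙 T₂ Z₁ false`; ONE flag-keeping inner step at the point `y₁` of the carrier line `Z₁` given by the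
chart `w₁` of `…TcPlusInnerStage` (`υᵢ`); the final clause with the blow-up `υ′` along the reduced strict transform `Z₉` of the line (`…TcPlusInnerStep`);
then (TC⁺) with the EMPTY inner chain at the point over `[1:0:0:0]` (transport along `υ′ ≫ υᵢ ≫ υ₁`). REGULARITY of `V(closure T₅)_red`: over `D₊(x₀)`
`…TcDeltaTwoStepGlobal`; over `D₊(x₃)` `…TcPlusThreeStepGlobal`; over `D₊(x₁) ∪ D₊(x₂)` all blow-ups are isomorphisms and `Γ₀ ≅ H` is smooth.
References: Hartshorne II 2.5, 7.16, Ex. 3.2.6; Stacks 0804, 080E; the `…SpecimenQuarticTcDelta*` / `…SpecimenQuarticTcPlus*` files.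
-/

set_option linter.dupNamespace false -- mandated namespace `Summit.<Summit>.<Problem>` of this single-conjunct summit

noncomputable section

open CategoryTheory CategoryTheory.Limits AlgebraicGeometry TopologicalSpace
open MvPolynomial
open AlgebraicGeometry.Scheme.IdealSheafData
open Literature.AlgebraicGeometry.Resolution
open Literature.AlgebraicGeometry.Motives
open Summit.ResolutionOfSingularities.ResolutionOfSingularities.Theorems.EquisingularLift

namespace Summit.ResolutionOfSingularities.ResolutionOfSingularities.Cruxes.EquisingularLiftNat.Sections

namespace SpecimenQuarticTcPlus

open SpecimenQuarticTcDelta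

attribute [local instance] MvPolynomial.gradedAlgebra ProjBaseChange.algebraBase

/-- **SPECIMEN-TC⁺.** The TC⁺ downstairs closure out of `(ℙ³, 𝟙, ι(H))` for the quartic `H = V(x₀²x₃² + x₁⁴ + x₂⁴)` (`char k = p ≠ 2`, `k = k̄`)
reaches a triple with REGULAR reduced strict transform, using a NON-EMPTY inner chain at the first point (one flag-keeping in-carrier point step,
then the carrier curve). This is the 5th explicit hypothesis of the registered stub `stub_elnat_tcPlusPointResolution` VERBATIM at `n := 3`,
`H := (hypersurface (SpecimenQuartic.form k)).left`, `ι := (hypersurfaceι (SpecimenQuartic.form k)).left`.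
[OURS · L1 W4.5(b) · EL♮(3) · SPECIMEN-TC⁺ non-vacuity certificate] -/
theorem tcPlusPointResolvable_quartic (p : ℕ) (hp : p.Prime) (hp2 : p ≠ 2) (k : Type) [Field k] [CharP k p] [IsAlgClosed k] :
      ∃ (F' : AlgebraicGeometry.Scheme.{0}) (ρ' : F' ⟶ (Literature.AlgebraicGeometry.Motives.projectiveSpace 3 k).left) (T' : Set F'), (∀ Q : (∀ F₁ :
      AlgebraicGeometry.Scheme.{0}, (F₁ ⟶ (Literature.AlgebraicGeometry.Motives.projectiveSpace 3 k).left) → Set F₁ → Prop), Q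
      (Literature.AlgebraicGeometry.Motives.projectiveSpace 3 k).left (CategoryTheory.CategoryStruct.id
      (Literature.AlgebraicGeometry.Motives.projectiveSpace 3 k).left) (Set.range (Literature.AlgebraicGeometry.Motives.SmoothHypersurface.hypersurfaceι
      (SpecimenQuartic.form k)).left) → (∀ (F₁ F₂ : AlgebraicGeometry.Scheme.{0}) (ρ : F₁ ⟶ (Literature.AlgebraicGeometry.Motives.projectiveSpace 3 k).left)
      (T₁ : Set F₁) (x : ↥(AlgebraicGeometry.Scheme.IdealSheafData.vanishingIdeal (⟨closure T₁, isClosed_closure⟩ : TopologicalSpace.Closeds F₁)).subscheme)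
      (υ : F₂ ⟶ F₁) (hx : IsClosed ({((AlgebraicGeometry.Scheme.IdealSheafData.vanishingIdeal (⟨closure T₁, isClosed_closure⟩ : TopologicalSpace.Closeds
      F₁)).subschemeι x : F₁)} : Set F₁)), Q F₁ ρ T₁ → ¬ IsRegularLocalRing ((AlgebraicGeometry.Scheme.IdealSheafData.vanishingIdeal (⟨closure T₁,
      isClosed_closure⟩ : TopologicalSpace.Closeds F₁)).subscheme.presheaf.stalk x) → IsRegularLocalRing (F₁.presheaf.stalk
      (((AlgebraicGeometry.Scheme.IdealSheafData.vanishingIdeal (⟨closure T₁, isClosed_closure⟩ : TopologicalSpace.Closeds F₁))).subschemeι x : F₁)) →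
      Literature.AlgebraicGeometry.Resolution.IsBlowup υ (AlgebraicGeometry.Scheme.IdealSheafData.vanishingIdeal
      (⟨{((AlgebraicGeometry.Scheme.IdealSheafData.vanishingIdeal (⟨closure T₁, isClosed_closure⟩ : TopologicalSpace.Closeds F₁)).subschemeι x : F₁)}, hx⟩ :
      TopologicalSpace.Closeds F₁)) → Q F₂ (CategoryTheory.CategoryStruct.comp υ ρ) (closure (υ ⁻¹' (T₁ \
      {((AlgebraicGeometry.Scheme.IdealSheafData.vanishingIdeal (⟨closure T₁, isClosed_closure⟩ : TopologicalSpace.Closeds F₁)).subschemeι x : F₁)})))) → (∀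
      (F₁ F₂ : AlgebraicGeometry.Scheme.{0}) (ρ : F₁ ⟶ (Literature.AlgebraicGeometry.Motives.projectiveSpace 3 k).left) (T₁ : Set F₁) (x :
      ↥((AlgebraicGeometry.Scheme.IdealSheafData.vanishingIdeal (⟨closure T₁, isClosed_closure⟩ : TopologicalSpace.Closeds F₁))).subscheme) (υ : F₂ ⟶ F₁)
      (hx : IsClosed ({(((AlgebraicGeometry.Scheme.IdealSheafData.vanishingIdeal (⟨closure T₁, isClosed_closure⟩ : TopologicalSpace.Closeds F₁))).subschemeι
      x : F₁)} : Set F₁)) (W : Set F₁) (F₉ : AlgebraicGeometry.Scheme.{0}) (β₉ : F₉ ⟶ F₂) (T₉ Z₉ : Set F₉) (b₉ : Bool) (hZ₉ : IsClosed Z₉) (F₁₀ :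
      AlgebraicGeometry.Scheme.{0}) (υ' : F₁₀ ⟶ F₉), Q F₁ ρ T₁ → ¬ IsRegularLocalRing (((AlgebraicGeometry.Scheme.IdealSheafData.vanishingIdeal (⟨closure
      T₁, isClosed_closure⟩ : TopologicalSpace.Closeds F₁))).subscheme.presheaf.stalk x) → IsRegularLocalRing (F₁.presheaf.stalk
      (((AlgebraicGeometry.Scheme.IdealSheafData.vanishingIdeal (⟨closure T₁, isClosed_closure⟩ : TopologicalSpace.Closeds F₁))).subschemeι x : F₁)) →
      Literature.AlgebraicGeometry.Resolution.IsBlowup υ (AlgebraicGeometry.Scheme.IdealSheafData.vanishingIdeal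
      (⟨{(((AlgebraicGeometry.Scheme.IdealSheafData.vanishingIdeal (⟨closure T₁, isClosed_closure⟩ : TopologicalSpace.Closeds F₁))).subschemeι x : F₁)}, hx⟩
      : TopologicalSpace.Closeds F₁)) → (((AlgebraicGeometry.Scheme.IdealSheafData.vanishingIdeal (⟨closure T₁, isClosed_closure⟩ : TopologicalSpace.Closeds
      F₁))).subschemeι x : F₁) ∈ W → ¬ (υ ⁻¹' {(((AlgebraicGeometry.Scheme.IdealSheafData.vanishingIdeal (⟨closure T₁, isClosed_closure⟩ :
      TopologicalSpace.Closeds F₁))).subschemeι x : F₁)} ⊆ closure (υ ⁻¹' (W \ {(((AlgebraicGeometry.Scheme.IdealSheafData.vanishingIdeal (⟨closure T₁,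
      isClosed_closure⟩ : TopologicalSpace.Closeds F₁))).subschemeι x : F₁)}))) → (∃ U : F₁.affineOpens,
      (((AlgebraicGeometry.Scheme.IdealSheafData.vanishingIdeal (⟨closure T₁, isClosed_closure⟩ : TopologicalSpace.Closeds F₁))).subschemeι x : F₁) ∈ (U :
      F₁.Opens) ∧ ((AlgebraicGeometry.Scheme.IdealSheafData.vanishingIdeal (⟨closure W, isClosed_closure⟩ : TopologicalSpace.Closeds F₁)).ideal
      U).IsPrincipal) → (υ ⁻¹' {(((AlgebraicGeometry.Scheme.IdealSheafData.vanishingIdeal (⟨closure T₁, isClosed_closure⟩ : TopologicalSpace.Closeds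
      F₁))).subschemeι x : F₁)} ∩ closure (υ ⁻¹' (W \ {(((AlgebraicGeometry.Scheme.IdealSheafData.vanishingIdeal (⟨closure T₁, isClosed_closure⟩ :
      TopologicalSpace.Closeds F₁))).subschemeι x : F₁)}))) ⊆ closure (υ ⁻¹' (T₁ \ {(((AlgebraicGeometry.Scheme.IdealSheafData.vanishingIdeal (⟨closure T₁,
      isClosed_closure⟩ : TopologicalSpace.Closeds F₁))).subschemeι x : F₁)})) → (∀ R : (∀ G : AlgebraicGeometry.Scheme.{0}, (G ⟶ F₂) → Set G → Set G → Bool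
      → Prop), R F₂ (CategoryTheory.CategoryStruct.id F₂) (closure (υ ⁻¹' (T₁ \ {(((AlgebraicGeometry.Scheme.IdealSheafData.vanishingIdeal (⟨closure T₁,
      isClosed_closure⟩ : TopologicalSpace.Closeds F₁))).subschemeι x : F₁)}))) (υ ⁻¹' {(((AlgebraicGeometry.Scheme.IdealSheafData.vanishingIdeal (⟨closure
      T₁, isClosed_closure⟩ : TopologicalSpace.Closeds F₁))).subschemeι x : F₁)} ∩ closure (υ ⁻¹' (W \
      {(((AlgebraicGeometry.Scheme.IdealSheafData.vanishingIdeal (⟨closure T₁, isClosed_closure⟩ : TopologicalSpace.Closeds F₁))).subschemeι x : F₁)})))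
      false → (∀ (G₁ G₂ : AlgebraicGeometry.Scheme.{0}) (β : G₁ ⟶ F₂) (T Z : Set G₁) (b : Bool) (y :
      ↥((AlgebraicGeometry.Scheme.IdealSheafData.vanishingIdeal (⟨closure Z, isClosed_closure⟩ : TopologicalSpace.Closeds G₁))).subscheme) (υ₁ : G₂ ⟶ G₁)
      (hy : IsClosed ({(((AlgebraicGeometry.Scheme.IdealSheafData.vanishingIdeal (⟨closure Z, isClosed_closure⟩ : TopologicalSpace.Closeds G₁))).subschemeι
      y : G₁)} : Set G₁)), R G₁ β T Z b → (((AlgebraicGeometry.Scheme.IdealSheafData.vanishingIdeal (⟨closure Z, isClosed_closure⟩ :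
      TopologicalSpace.Closeds G₁))).subschemeι y : G₁) ∈ T → IsRegularLocalRing (((AlgebraicGeometry.Scheme.IdealSheafData.vanishingIdeal (⟨closure Z,
      isClosed_closure⟩ : TopologicalSpace.Closeds G₁))).subscheme.presheaf.stalk y) → IsRegularLocalRing (G₁.presheaf.stalk
      (((AlgebraicGeometry.Scheme.IdealSheafData.vanishingIdeal (⟨closure Z, isClosed_closure⟩ : TopologicalSpace.Closeds G₁))).subschemeι y : G₁)) →
      Literature.AlgebraicGeometry.Resolution.IsBlowup υ₁ (AlgebraicGeometry.Scheme.IdealSheafData.vanishingIdeal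
      (⟨{(((AlgebraicGeometry.Scheme.IdealSheafData.vanishingIdeal (⟨closure Z, isClosed_closure⟩ : TopologicalSpace.Closeds G₁))).subschemeι y : G₁)}, hy⟩
      : TopologicalSpace.Closeds G₁)) → R G₂ (CategoryTheory.CategoryStruct.comp υ₁ β) (closure (υ₁ ⁻¹' (T \
      {(((AlgebraicGeometry.Scheme.IdealSheafData.vanishingIdeal (⟨closure Z, isClosed_closure⟩ : TopologicalSpace.Closeds G₁))).subschemeι y : G₁)})))
      (closure (υ₁ ⁻¹' (Z \ {(((AlgebraicGeometry.Scheme.IdealSheafData.vanishingIdeal (⟨closure Z, isClosed_closure⟩ : TopologicalSpace.Closeds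
      G₁))).subschemeι y : G₁)}))) b) → (∀ (G₁ G₂ : AlgebraicGeometry.Scheme.{0}) (β : G₁ ⟶ F₂) (T Z : Set G₁) (y :
      ↥((AlgebraicGeometry.Scheme.IdealSheafData.vanishingIdeal (⟨closure Z, isClosed_closure⟩ : TopologicalSpace.Closeds G₁))).subscheme) (υ₁ : G₂ ⟶ G₁)
      (hy : IsClosed ({(((AlgebraicGeometry.Scheme.IdealSheafData.vanishingIdeal (⟨closure Z, isClosed_closure⟩ : TopologicalSpace.Closeds G₁))).subschemeι
      y : G₁)} : Set G₁)), R G₁ β T Z false → (((AlgebraicGeometry.Scheme.IdealSheafData.vanishingIdeal (⟨closure Z, isClosed_closure⟩ :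
      TopologicalSpace.Closeds G₁))).subschemeι y : G₁) ∈ T → ¬ IsRegularLocalRing (((AlgebraicGeometry.Scheme.IdealSheafData.vanishingIdeal (⟨closure Z,
      isClosed_closure⟩ : TopologicalSpace.Closeds G₁))).subscheme.presheaf.stalk y) → IsRegularLocalRing (G₁.presheaf.stalk
      (((AlgebraicGeometry.Scheme.IdealSheafData.vanishingIdeal (⟨closure Z, isClosed_closure⟩ : TopologicalSpace.Closeds G₁))).subschemeι y : G₁)) →
      Literature.AlgebraicGeometry.Resolution.IsBlowup υ₁ (AlgebraicGeometry.Scheme.IdealSheafData.vanishingIdeal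
      (⟨{(((AlgebraicGeometry.Scheme.IdealSheafData.vanishingIdeal (⟨closure Z, isClosed_closure⟩ : TopologicalSpace.Closeds G₁))).subschemeι y : G₁)}, hy⟩
      : TopologicalSpace.Closeds G₁)) → R G₂ (CategoryTheory.CategoryStruct.comp υ₁ β) (closure (υ₁ ⁻¹' (T \
      {(((AlgebraicGeometry.Scheme.IdealSheafData.vanishingIdeal (⟨closure Z, isClosed_closure⟩ : TopologicalSpace.Closeds G₁))).subschemeι y : G₁)})))
      (closure (υ₁ ⁻¹' (Z \ {(((AlgebraicGeometry.Scheme.IdealSheafData.vanishingIdeal (⟨closure Z, isClosed_closure⟩ : TopologicalSpace.Closeds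
      G₁))).subschemeι y : G₁)}))) true) → R F₉ β₉ T₉ Z₉ b₉) → Z₉ ⊆ T₉ → ¬ (T₉ ⊆ Z₉) → Set.Finite {z :
      ↥((AlgebraicGeometry.Scheme.IdealSheafData.vanishingIdeal (⟨Z₉, hZ₉⟩ : TopologicalSpace.Closeds F₉))).subscheme | ¬ IsRegularLocalRing
      (((AlgebraicGeometry.Scheme.IdealSheafData.vanishingIdeal (⟨Z₉, hZ₉⟩ : TopologicalSpace.Closeds F₉))).subscheme.presheaf.stalk z)} →
      Literature.AlgebraicGeometry.Resolution.IsBlowup υ' (AlgebraicGeometry.Scheme.IdealSheafData.vanishingIdeal (⟨Z₉, hZ₉⟩ : TopologicalSpace.Closeds F₉))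
      → Q F₁₀ (CategoryTheory.CategoryStruct.comp (CategoryTheory.CategoryStruct.comp (CategoryTheory.CategoryStruct.comp υ' β₉) υ) ρ) (closure (υ' ⁻¹' (T₉
      \ Z₉)))) → Q F' ρ' T') ∧ Literature.AlgebraicGeometry.Resolution.Scheme.IsRegular (AlgebraicGeometry.Scheme.IdealSheafData.vanishingIdeal (⟨closure
      T', isClosed_closure⟩ : TopologicalSpace.Closeds F')).subscheme := by
  have h2 : (2 : k) ≠ 0 := two_ne_zero_of_charP p hp hp2 k
  have h2' : IsUnit (2 : k) := isUnit_iff_ne_zero.mpr h2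
  haveI : IsLocallyNoetherian (P3 k) := isLocallyNoetherian_P3 k
  -- ### Stage 0: the point `x₁` of `Γ₀ = V(closure ι(H))_red` over `v = u3(o) = [0:0:0:1]`
  obtain ⟨x₁, hx₁⟩ := exists_point_Γ₀ k (preimage_u3_range_ι k)
  set v : P3 k := ((vanishingIdeal (⟨closure (Set.range (ιQ k)), isClosed_closure⟩ : Closeds (P3 k))).subschemeι x₁ : P3 k)
    with hv
  have hx₁c : IsClosed ({v} : Set (P3 k)) := by
    rw [hx₁]; exact isClosed_singleton_chart_o k (u3 k)
  have e₁ : (⟨{v}, hx₁c⟩ : Closeds (P3 k)) = ⟨{u3 k (o k)}, isClosed_singleton_chart_o k (u3 k)⟩ := Closeds.ext (by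
    change ({_} : Set (P3 k)) = {_}; rw [hx₁])
  have hux₁ : (vanishingIdeal (⟨{v}, hx₁c⟩ : Closeds (P3 k))).comap (u3 k) =
      ofIdealTop ((PointBlowup.originIdeal 2 k).map (Scheme.ΓSpecIso (CommRingCat.of (MvPolynomial (Fin 3) k))).inv.hom) := by
    rw [e₁]; exact comap_vanishingIdeal_singleton_chart_o k (u3 k)
  have huT₁ := comap_u3_vanishingIdeal_range k h2
  -- ### Step 1a: blow up `ℙ³` at `v`
  obtain ⟨F₂, υ₁, hυ₁⟩ := exists_isBlowup (P3 k) (vanishingIdeal (⟨{v}, hx₁c⟩ : Closeds (P3 k)))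
  haveI : IsLocallyNoetherian F₂ := hυ₁.isLocallyNoetherian
  set T₂ : Set F₂ := closure (υ₁ ⁻¹' (Set.range (ιQ k) \ {v})) with hT₂
  set Z₁ : Set F₂ := υ₁ ⁻¹' {v} ∩ closure (υ₁ ⁻¹' (Set.range (ιQ k) \ {v})) with hZ₁def
  have hZ₁ : IsClosed Z₁ := isClosed_inter (T := Set.range (ιQ k)) hx₁c υ₁
  -- the clauses of the point step at `v`
  have c₁₆ := not_exc_subset_strict (u3 k) hx₁c hux₁ (isClosed_range_ι k) huT₁ hυ₁
  have c₁₉ := not_strict_subset_inter (u3 k) hx₁c hux₁ (isClosed_range_ι k) huT₁ h2 hυ₁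
  have hZ₁reg := isRegular_inter (u3 k) hx₁c hux₁ (isClosed_range_ι k) huT₁ h2 (hx₁ ▸ ⟨o k, rfl⟩) hυ₁
  have c₁₇ : ∃ U : (P3 k).affineOpens, v ∈ (U : (P3 k).Opens) ∧
      ((vanishingIdeal (⟨closure (Set.range (ιQ k)), isClosed_closure⟩ : Closeds (P3 k))).ideal U).IsPrincipal :=
    ⟨chartOpen (u3 k), by rw [hx₁]; exact mem_chartOpen_of_mem_range (u3 k) ⟨o k, rfl⟩,
      isPrincipal_ideal_chartOpen (u3 k) (isClosed_range_ι k) huT₁⟩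
  have c₁₂ := not_isRegularLocalRing_Γ₀ k h2 (preimage_u3_range_ι k) x₁ hx₁
  have c₁₃ : IsRegularLocalRing ((P3 k).presheaf.stalk v) := by
    rw [hx₁]; exact isRegularLocalRing_stalk_chart_o k (u3 k)
  have c₁₅ : v ∈ Set.range (ιQ k) := by
    rw [hx₁]; exact chart_o_mem_range k (preimage_u3_range_ι k)
  -- ### Step 1b: the chart `w₁` centred at the inner point `y₁` of the carrier line, and the point `y` of `V(closure Z₁)_red` over it
  obtain ⟨w₁, hw₁oi, hw₁S, hw₁Z, hw₁o⟩ := exists_innerChart (u3 k) hx₁c hux₁ (isClosed_range_ι k) huT₁ h2 hυ₁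
  haveI : IsOpenImmersion w₁ := hw₁oi
  haveI : JacobsonSpace (P3 k) := jacobsonSpace_P3 k
  haveI : JacobsonSpace F₂ := jacobsonSpace_of_isBlowup hυ₁
  have hc₁ : IsClosed ({w₁ (o k)} : Set F₂) := isClosed_singleton_chart_of_jacobson w₁
  obtain ⟨y, hy'⟩ := exists_point_carrier w₁ (Z := Z₁) hw₁o
  set y₁ : F₂ := ((vanishingIdeal (⟨closure Z₁, isClosed_closure⟩ : Closeds F₂)).subschemeι y : F₂) with hy₁def
  have hy₁c : IsClosed ({y₁} : Set F₂) := by rw [hy']; exact hc₁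
  have e_y : (⟨{y₁}, hy₁c⟩ : Closeds F₂) = ⟨{w₁ (o k)}, hc₁⟩ := Closeds.ext (by change ({_} : Set F₂) = {_}; rw [hy'])
  -- ### Step 1c: the inner blow-up at `y₁`, then the blow-up along the reduced strict transform `Z₉` of the carrier line
  obtain ⟨F₂', υᵢ, hυᵢ⟩ := exists_isBlowup F₂ (vanishingIdeal (⟨{y₁}, hy₁c⟩ : Closeds F₂))
  have hυᵢ' : IsBlowup υᵢ (vanishingIdeal (⟨{w₁ (o k)}, hc₁⟩ : Closeds F₂)) := by rw [← e_y]; exact hυᵢ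
  haveI : IsLocallyNoetherian F₂' := hυᵢ.isLocallyNoetherian
  set T₉ : Set F₂' := closure (υᵢ ⁻¹' (T₂ \ {y₁})) with hT₉
  set Z₉ : Set F₂' := closure (υᵢ ⁻¹' (Z₁ \ {y₁})) with hZ₉
  obtain ⟨F₃, υ', hυ'⟩ := exists_isBlowup F₂' (vanishingIdeal (⟨Z₉, isClosed_closure⟩ : Closeds F₂'))
  haveI : IsLocallyNoetherian F₃ := hυ'.isLocallyNoetherian
  -- the inputs of the inner constructor at `y`
  have hyT : y₁ ∈ T₂ := by rw [hy']; exact hw₁o.2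
  have hyreg : IsRegularLocalRing ((vanishingIdeal (⟨closure Z₁, isClosed_closure⟩ : Closeds F₂)).subscheme.presheaf.stalk y) :=
    isRegularLocalRing_carrier hZ₁ hZ₁reg y
  have hF₂reg : IsRegularLocalRing (F₂.presheaf.stalk y₁) := by rw [hy']; exact isRegularLocalRing_stalk_chart w₁
  -- the inputs of the final clause
  have hZ₉T₉ : Z₉ ⊆ T₉ := by
    have h := lineStrict_subset_strict w₁ (Z := Z₁) (T := T₂) Set.inter_subset_right υᵢ
    rw [← hy'] at h; exact h
  have hT₉Z₉ : ¬ T₉ ⊆ Z₉ := by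
    have h := not_strict_subset_lineStrict w₁ hc₁ hZ₁ (T := T₂) hw₁o c₁₉ hυᵢ'
    rw [← hy'] at h; exact h
  have hfin₉ : Set.Finite {z : (vanishingIdeal (⟨Z₉, isClosed_closure⟩ : Closeds F₂')).subscheme |
      ¬ IsRegularLocalRing ((vanishingIdeal (⟨Z₉, isClosed_closure⟩ : Closeds F₂')).subscheme.presheaf.stalk z)} := by
    have H : ∀ (y₀ : F₂) (hy₀ : w₁ (o k) = y₀) (hZ₉c : IsClosed (closure (υᵢ ⁻¹' (Z₁ \ {y₀})))),
        Set.Finite {z : (vanishingIdeal (⟨closure (υᵢ ⁻¹' (Z₁ \ {y₀})), hZ₉c⟩ : Closeds F₂')).subscheme |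
          ¬ IsRegularLocalRing ((vanishingIdeal (⟨closure (υᵢ ⁻¹' (Z₁ \ {y₀})), hZ₉c⟩ : Closeds F₂')).subscheme.presheaf.stalk z)} := by
      intro y₀ hy₀ hZ₉c
      subst hy₀
      exact finite_nonregular_lineStrict w₁ hc₁ hZ₁ hw₁Z hZ₁reg hυᵢ' hZ₉c
    exact H y₁ (by rw [hy']) isClosed_closure
  -- ### Notation for the sets of step 1
  set T₃ : Set F₃ := closure (υ' ⁻¹' (T₉ \ Z₉)) with hT₃
  have hT₃c : IsClosed T₃ := isClosed_closure
  -- ### Transport to `F₃`: `σ = (υ' ≫ υᵢ) ≫ υ₁` is an isomorphism over `D₊(x₀) = u0(Spec k[X])`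
  have hvO : v ∉ Set.range (u0 k) := by rw [hx₁]; exact u3_o_not_mem_range_u0 k
  have hυ₁y₁ : υ₁ y₁ = v := by
    have h : y₁ ∈ Z₁ := by rw [hy']; exact hw₁o
    exact h.1
  haveI iso₁ : IsIso (υ₁ ∣_ (u0 k).opensRange) := hυ₁.isIso_morphismRestrict (by
    rw [Scheme.IdealSheafData.coe_support_vanishingIdeal]
    change Disjoint (Set.range (u0 k)) {v}
    rw [Set.disjoint_singleton_right]
    exact hvO)
  haveI isoᵢ : IsIso (υᵢ ∣_ (υ₁ ⁻¹ᵁ (u0 k).opensRange)) := hυᵢ.isIso_morphismRestrict (by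
    rw [Scheme.IdealSheafData.coe_support_vanishingIdeal]
    change Disjoint (υ₁ ⁻¹' Set.range (u0 k)) {y₁}
    rw [Set.disjoint_singleton_right]
    intro h
    exact hvO (by rw [← hυ₁y₁]; exact h))
  haveI iso' : IsIso (υ' ∣_ ((υᵢ ≫ υ₁) ⁻¹ᵁ (u0 k).opensRange)) := hυ'.isIso_morphismRestrict (by
    rw [Scheme.IdealSheafData.coe_support_vanishingIdeal]
    change Disjoint ((υᵢ ≫ υ₁) ⁻¹' Set.range (u0 k)) Z₉
    rw [Set.disjoint_left]
    intro z hz hzZ₉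
    have h1 : υᵢ z ∈ Z₁ := lineStrict_subset_preimage w₁ hZ₁ υᵢ (by rw [← hy']; exact hzZ₉)
    have h2 : υ₁ (υᵢ z) = v := h1.1
    apply hvO
    rw [← h2]
    have : (υᵢ ≫ υ₁) z ∈ Set.range (u0 k) := hz
    rwa [Scheme.Hom.comp_apply] at this)
  haveI isoᵢ₁ : IsIso ((υᵢ ≫ υ₁) ∣_ (u0 k).opensRange) := by
    rw [morphismRestrict_comp]; exact @IsIso.comp_isIso _ _ _ _ _ _ _ isoᵢ iso₁
  haveI iso₃ : IsIso (((υ' ≫ υᵢ) ≫ υ₁) ∣_ (u0 k).opensRange) := by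
    rw [Category.assoc, morphismRestrict_comp]; exact @IsIso.comp_isIso _ _ _ _ _ _ _ iso' isoᵢ₁
  have hσpre : ∀ A : Set (P3 k), ((υ' ≫ υᵢ) ≫ υ₁) ⁻¹' A = υ' ⁻¹' (υᵢ ⁻¹' (υ₁ ⁻¹' A)) := fun A => by
    ext a; simp only [Set.mem_preimage, Scheme.Hom.comp_apply]
  have hσpre₂ : ∀ A : Set (P3 k), (υᵢ ≫ υ₁) ⁻¹' A = υᵢ ⁻¹' (υ₁ ⁻¹' A) := fun A => by
    ext a; simp only [Set.mem_preimage, Scheme.Hom.comp_apply]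
  -- the strict transforms over `D₊(x₀)`
  have hO : IsOpen (Set.range (u0 k)) := (u0 k).isOpenEmbedding.isOpen_range
  have hint₂ : T₂ ∩ υ₁ ⁻¹' Set.range (u0 k) = υ₁ ⁻¹' Set.range (ιQ k) ∩ υ₁ ⁻¹' Set.range (u0 k) :=
    strictTransform_inter_preimage_eq υ₁ hO (isClosed_range_ι k) rfl (by
      rw [Set.singleton_inter_eq_empty]; exact hvO)
  have hint₉ : T₉ ∩ υᵢ ⁻¹' (υ₁ ⁻¹' Set.range (u0 k)) = υᵢ ⁻¹' (υ₁ ⁻¹' Set.range (ιQ k)) ∩ υᵢ ⁻¹' (υ₁ ⁻¹' Set.range (u0 k)) :=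
    strictTransform_inter_preimage_eq υᵢ (hO.preimage υ₁.continuous) ((isClosed_range_ι k).preimage υ₁.continuous) hint₂ (by
      rw [Set.singleton_inter_eq_empty]
      intro h
      exact hvO (by rw [← hυ₁y₁]; exact h))
  have hZ₉O : Z₉ ∩ υᵢ ⁻¹' (υ₁ ⁻¹' Set.range (u0 k)) = ∅ := by
    rw [← Set.disjoint_iff_inter_eq_empty, Set.disjoint_left]
    intro z hzZ₉ hz
    have h1 : υᵢ z ∈ Z₁ := lineStrict_subset_preimage w₁ hZ₁ υᵢ (by rw [← hy']; exact hzZ₉)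
    have h2 : υ₁ (υᵢ z) = v := h1.1
    exact hvO (by rw [← h2]; exact hz)
  have hint₃ : T₃ ∩ ((υ' ≫ υᵢ) ≫ υ₁) ⁻¹' Set.range (u0 k) = ((υ' ≫ υᵢ) ≫ υ₁) ⁻¹' (Set.range (ιQ k) ∩ Set.range (u0 k)) := by
    rw [hσpre, hσpre, Set.preimage_inter, Set.preimage_inter]
    exact strictTransform_inter_preimage_eq υ' ((hO.preimage υ₁.continuous).preimage υᵢ.continuous)
      (((isClosed_range_ι k).preimage υ₁.continuous).preimage υᵢ.continuous) hint₉ hZ₉O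
  -- the lifted chart `u₂` at `[1:0:0:0]` and its data
  set u₂ := liftChart ((υ' ≫ υᵢ) ≫ υ₁) (u0 k) with hu₂
  have hc₂ : IsClosed ({u₂ (o k)} : Set F₃) :=
    isClosed_singleton_liftChart ((υ' ≫ υᵢ) ≫ υ₁) (u0 k) (isClosed_singleton_chart_o k (u0 k))
  have hmem₂ : u₂ (o k) ∈ T₃ := liftChart_o_mem ((υ' ≫ υᵢ) ≫ υ₁) (u0 k) hint₃ (chart_o_mem_range k (preimage_u0_range_ι k))
  have huT₂ : (vanishingIdeal (⟨T₃, hT₃c⟩ : Closeds F₃)).comap u₂ =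
      ofIdealTop ((Ideal.span {(X 2 ^ 2 + X 0 ^ 4 + X 1 ^ 4 : MvPolynomial (Fin 3) k)}).map
        (Scheme.ΓSpecIso (CommRingCat.of (MvPolynomial (Fin 3) k))).inv.hom) :=
    (comap_liftChart_of_inter_eq ((υ' ≫ υᵢ) ≫ υ₁) (u0 k) hT₃c (isClosed_range_ι k) hint₃).trans (comap_u0_vanishingIdeal_range k h2)
  -- irreducibility of the strict transforms
  have hvne : u0 k (o k) ≠ v := fun h => hvO (h ▸ ⟨o k, rfl⟩)
  have hT₂irr : IsIrreducible T₂ :=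
    isIrreducible_strictTransform_of_isBlowup ⟨{v}, hx₁c⟩ hυ₁ (isIrreducible_range_ι k h2) (fun hsub =>
      hvne (Set.mem_singleton_iff.mp (hsub (chart_o_mem_range k (preimage_u0_range_ι k)))))
  have hT₉irr : IsIrreducible T₉ := isIrreducible_strictTransform_of_isBlowup ⟨{y₁}, hy₁c⟩ hυᵢ hT₂irr (fun hsub => by
    apply c₁₉
    intro t ht
    rw [Set.mem_singleton_iff.mp (hsub ht)]
    rw [hy']; exact hw₁o)
  have hT₃irr : IsIrreducible T₃ := isIrreducible_strictTransform_of_isBlowup ⟨Z₉, isClosed_closure⟩ hυ' hT₉irr hT₉Z₉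
  -- the point `x'` of `Γ₃ = V(closure T₃)_red` over `p' = u₂(o)`
  obtain ⟨x', hx'⟩ := exists_point_subscheme_of_mem u₂ hmem₂
  have hx'c : IsClosed ({((vanishingIdeal (⟨closure T₃, isClosed_closure⟩ : Closeds F₃)).subschemeι x' : F₃)} : Set F₃) := by
    rw [hx']; exact hc₂
  have e₂ : (⟨{((vanishingIdeal (⟨closure T₃, isClosed_closure⟩ : Closeds F₃)).subschemeι x' : F₃)}, hx'c⟩ : Closeds F₃) =
      ⟨{u₂ (o k)}, hc₂⟩ := Closeds.ext (by change ({_} : Set F₃) = {_}; rw [hx'])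
  have hux₂ : (vanishingIdeal (⟨{((vanishingIdeal (⟨closure T₃, isClosed_closure⟩ : Closeds F₃)).subschemeι x' : F₃)}, hx'c⟩ :
      Closeds F₃)).comap u₂ =
      ofIdealTop ((PointBlowup.originIdeal 2 k).map (Scheme.ΓSpecIso (CommRingCat.of (MvPolynomial (Fin 3) k))).inv.hom) := by
    rw [e₂]; exact comap_vanishingIdeal_singleton_chart u₂ hc₂
  -- ### Step 2: blow up `F₃` at `p'`, then `F₄` at `Z₂` (the EMPTY inner chain)
  obtain ⟨F₄, υ₂, hυ₂⟩ := exists_isBlowup F₃ (vanishingIdeal (⟨{((vanishingIdeal (⟨closure T₃, isClosed_closure⟩ :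
    Closeds F₃)).subschemeι x' : F₃)}, hx'c⟩ : Closeds F₃))
  have hZ₂ := isClosed_inter (T := T₃) hx'c υ₂
  obtain ⟨F₅, υ₂', hυ₂'⟩ := exists_isBlowup F₄ (vanishingIdeal (⟨_, hZ₂⟩ : Closeds F₄))
  have c₂₆ := not_exc_subset_strict u₂ hx'c hux₂ hT₃c huT₂ hυ₂
  have c₂₉ := not_strict_subset_inter u₂ hx'c hux₂ hT₃c huT₂ h2 hυ₂
  have c₂₁₀ := finite_nonregular_inter u₂ hx'c hux₂ hT₃c huT₂ h2 (hx' ▸ ⟨o k, rfl⟩) hυ₂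
  have c₂₇ : ∃ U : F₃.affineOpens, ((vanishingIdeal (⟨closure T₃, isClosed_closure⟩ : Closeds F₃)).subschemeι x' : F₃) ∈
      (U : F₃.Opens) ∧ ((vanishingIdeal (⟨closure T₃, isClosed_closure⟩ : Closeds F₃)).ideal U).IsPrincipal :=
    ⟨chartOpen u₂, by rw [hx']; exact mem_chartOpen_of_mem_range u₂ ⟨o k, rfl⟩, isPrincipal_ideal_chartOpen u₂ hT₃c huT₂⟩
  have c₂₂ := not_isRegularLocalRing_subscheme_of_chart u₂ hT₃c hT₃irr huT₂ x' hx'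
  have c₂₃ : IsRegularLocalRing (F₃.presheaf.stalk ((vanishingIdeal (⟨closure T₃, isClosed_closure⟩ : Closeds F₃)).subschemeι x')) := by
    rw [hx']; exact isRegularLocalRing_stalk_chart u₂
  have c₂₅ : ((vanishingIdeal (⟨closure T₃, isClosed_closure⟩ : Closeds F₃)).subschemeι x' : F₃) ∈ T₃ := by rw [hx']; exact hmem₂
  -- ### The witness
  refine ⟨F₅, ((υ₂' ≫ 𝟙 F₄) ≫ υ₂) ≫ (((υ' ≫ (υᵢ ≫ 𝟙 F₂)) ≫ υ₁) ≫ 𝟙 (P3 k)),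
    closure (υ₂' ⁻¹' (closure (υ₂ ⁻¹' (T₃ \ {((vanishingIdeal (⟨closure T₃, isClosed_closure⟩ : Closeds F₃)).subschemeι x' : F₃)})) \
      (υ₂ ⁻¹' {((vanishingIdeal (⟨closure T₃, isClosed_closure⟩ : Closeds F₃)).subschemeι x' : F₃)} ∩
        closure (υ₂ ⁻¹' (T₃ \ {((vanishingIdeal (⟨closure T₃, isClosed_closure⟩ : Closeds F₃)).subschemeι x' : F₃)}))))),
    fun Q hbase _ hTC => ?_, ?_⟩
  · -- step 1: (TC⁺) at `v` with ONE inner step at `y`, then the final clause; step 2: (TC⁺) at `p'` with the EMPTY inner chain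
    have step₁ : Q F₃ (((υ' ≫ (υᵢ ≫ 𝟙 F₂)) ≫ υ₁) ≫ 𝟙 (P3 k)) T₃ :=
      hTC (P3 k) F₂ (𝟙 (P3 k)) (Set.range (ιQ k)) x₁ υ₁ hx₁c (Set.range (ιQ k)) F₂' (υᵢ ≫ 𝟙 F₂) T₉ Z₉ false isClosed_closure F₃ υ'
        hbase c₁₂ c₁₃ hυ₁ c₁₅ c₁₆ c₁₇ Set.inter_subset_right
        (fun R hRbase hRi _ => hRi F₂ F₂' (𝟙 F₂) T₂ Z₁ false y υᵢ hy₁c hRbase hyT hyreg hF₂reg hυᵢ)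
        hZ₉T₉ hT₉Z₉ hfin₉ hυ'
    exact hTC F₃ F₄ (((υ' ≫ (υᵢ ≫ 𝟙 F₂)) ≫ υ₁) ≫ 𝟙 (P3 k)) T₃ x' υ₂ hx'c T₃ F₄ (𝟙 F₄)
      (closure (υ₂ ⁻¹' (T₃ \ {((vanishingIdeal (⟨closure T₃, isClosed_closure⟩ : Closeds F₃)).subschemeι x' : F₃)})))
      (υ₂ ⁻¹' {((vanishingIdeal (⟨closure T₃, isClosed_closure⟩ : Closeds F₃)).subschemeι x' : F₃)} ∩
        closure (υ₂ ⁻¹' (T₃ \ {((vanishingIdeal (⟨closure T₃, isClosed_closure⟩ : Closeds F₃)).subschemeι x' : F₃)})))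
      false hZ₂ F₅ υ₂'
      step₁ c₂₂ c₂₃ hυ₂ c₂₅ c₂₆ c₂₇ Set.inter_subset_right (fun R hRbase _ _ => hRbase) Set.inter_subset_right c₂₉ c₂₁₀ hυ₂'
  · -- ### Final regularity of `V(closure T₅)_red`
    -- the opens of `ℙ³` off the singular points
    let O₁₂ : (P3 k).Opens := (ProjectiveSpaceCells.chartι k 3 1).opensRange ⊔ (ProjectiveSpaceCells.chartι k 3 2).opensRange
    have hmemO₁₂ : ∀ y : P3 k, y ∈ O₁₂ ↔ y ∈ Set.range (ProjectiveSpaceCells.chartι k 3 1) ∨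
        y ∈ Set.range (ProjectiveSpaceCells.chartι k 3 2) := fun y => by
      change y ∈ ((_ ⊔ _ : (P3 k).Opens) : Set (P3 k)) ↔ _
      rw [Opens.coe_sup, Set.mem_union]
      exact Iff.rfl
    have hvO₁₂ : v ∉ O₁₂ := fun h => by
      rcases (hmemO₁₂ v).mp h with h | h
      · exact u3_o_not_mem_range_chartι k 1 (by decide) (hx₁ ▸ h)
      · exact u3_o_not_mem_range_chartι k 2 (by decide) (hx₁ ▸ h)
    have hregΓ₀ : ∀ x : (vanishingIdeal (⟨closure (Set.range (ιQ k)), isClosed_closure⟩ : Closeds (P3 k))).subscheme,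
        (vanishingIdeal (⟨closure (Set.range (ιQ k)), isClosed_closure⟩ : Closeds (P3 k))).subschemeι x ∈ O₁₂ →
        IsRegularLocalRing ((vanishingIdeal (⟨closure (Set.range (ιQ k)), isClosed_closure⟩ :
          Closeds (P3 k))).subscheme.presheaf.stalk x) := fun x hx => by
      rcases (hmemO₁₂ _).mp hx with h | h
      · exact isRegularLocalRing_Γ₀_far k h2 1 (Or.inl rfl) x h
      · exact isRegularLocalRing_Γ₀_far k h2 2 (Or.inr rfl) x h
    -- step 1: `Γ₃` is regular over `D₊(x₃)` (THREE-step) and over `D₊(x₁) ∪ D₊(x₂)` (isomorphisms over a smooth region)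
    have reg₃ := isRegularLocalRing_threeStep_of_mem_range' (u3 k) hx₁.symm hx₁c (isClosed_range_ι k) (isIrreducible_range_ι k h2)
      huT₁ c₁₅ h2 hυ₁ w₁ hy'.symm hy₁c hw₁S hw₁Z (by rw [hy']; exact hw₁o) hυᵢ hυ'
    have reg₃' := isRegularLocalRing_threeStep_of_mem_open' (u3 k) hx₁.symm hx₁c (isClosed_range_ι k) hυ₁ w₁ hy'.symm hy₁c
      (by rw [hy']; exact hw₁o) hυᵢ hυ' O₁₂ hvO₁₂ hregΓ₀
    -- step 2
    let O₃ : F₃.Opens := ((υ' ≫ υᵢ) ≫ υ₁) ⁻¹ᵁ (u3 k).opensRange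
    let O₁₂' : F₃.Opens := ((υ' ≫ υᵢ) ≫ υ₁) ⁻¹ᵁ O₁₂
    have hσu₂ : ((υ' ≫ υᵢ) ≫ υ₁) (u₂ (o k)) = u0 k (o k) := σ_liftChart_apply ((υ' ≫ υᵢ) ≫ υ₁) (u0 k) (o k)
    have hp'O₃ : ((vanishingIdeal (⟨closure T₃, isClosed_closure⟩ : Closeds F₃)).subschemeι x' : F₃) ∉ O₃ := fun h => by
      rw [hx'] at h
      change ((υ' ≫ υᵢ) ≫ υ₁) (u₂ (o k)) ∈ Set.range (u3 k) at h
      rw [hσu₂] at h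
      exact u0_o_not_mem_range_u3 k h
    have hp'O₁₂ : ((vanishingIdeal (⟨closure T₃, isClosed_closure⟩ : Closeds F₃)).subschemeι x' : F₃) ∉ O₁₂' := fun h => by
      rw [hx'] at h
      change ((υ' ≫ υᵢ) ≫ υ₁) (u₂ (o k)) ∈ O₁₂ at h
      rw [hσu₂] at h
      rcases (hmemO₁₂ _).mp h with h | h
      · exact u0_o_not_mem_range_chartι k 1 (by decide) h
      · exact u0_o_not_mem_range_chartι k 2 (by decide) h
    have hσapp : ∀ x : (vanishingIdeal (⟨closure T₃, isClosed_closure⟩ : Closeds F₃)).subscheme,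
        ((υ' ≫ υᵢ) ≫ υ₁) ((vanishingIdeal (⟨closure T₃, isClosed_closure⟩ : Closeds F₃)).subschemeι x) =
          υ₁ (υᵢ (υ' ((vanishingIdeal (⟨closure T₃, isClosed_closure⟩ : Closeds F₃)).subschemeι x))) := fun x => by
      simp only [Scheme.Hom.comp_apply]
    have hregO₃ : ∀ x : (vanishingIdeal (⟨closure T₃, isClosed_closure⟩ : Closeds F₃)).subscheme,
        ((vanishingIdeal (⟨closure T₃, isClosed_closure⟩ : Closeds F₃)).subschemeι x : F₃) ∈ O₃ →
        IsRegularLocalRing ((vanishingIdeal (⟨closure T₃, isClosed_closure⟩ : Closeds F₃)).subscheme.presheaf.stalk x) :=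
      fun x hx => reg₃ x (by
        change ((υ' ≫ υᵢ) ≫ υ₁) _ ∈ Set.range (u3 k) at hx
        rw [hσapp] at hx
        exact hx)
    have hregO₁₂ : ∀ x : (vanishingIdeal (⟨closure T₃, isClosed_closure⟩ : Closeds F₃)).subscheme,
        ((vanishingIdeal (⟨closure T₃, isClosed_closure⟩ : Closeds F₃)).subschemeι x : F₃) ∈ O₁₂' →
        IsRegularLocalRing ((vanishingIdeal (⟨closure T₃, isClosed_closure⟩ : Closeds F₃)).subscheme.presheaf.stalk x) :=
      fun x hx => reg₃' x (by
        change ((υ' ≫ υᵢ) ≫ υ₁) _ ∈ O₁₂ at hx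
        rw [hσapp] at hx
        exact hx)
    intro z
    obtain ⟨i, hi⟩ := exists_mem_range_chartι k (((υ' ≫ υᵢ) ≫ υ₁) (υ₂ (υ₂' ((vanishingIdeal (⟨closure (closure (υ₂' ⁻¹' (closure
      (υ₂ ⁻¹' (T₃ \ {((vanishingIdeal (⟨closure T₃, isClosed_closure⟩ : Closeds F₃)).subschemeι x' : F₃)})) \
      (υ₂ ⁻¹' {((vanishingIdeal (⟨closure T₃, isClosed_closure⟩ : Closeds F₃)).subschemeι x' : F₃)} ∩
      closure (υ₂ ⁻¹' (T₃ \ {((vanishingIdeal (⟨closure T₃, isClosed_closure⟩ : Closeds F₃)).subschemeι x' : F₃)})))))),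
      isClosed_closure⟩ : Closeds F₅)).subschemeι z))))
    have hi' : i = 0 ∨ i = 3 ∨ (i = 1 ∨ i = 2) := by fin_cases i <;> simp
    rcases hi' with rfl | rfl | h12
    · -- over `D₊(x₀)`: the two-step at `[1:0:0:0]`
      refine isRegularLocalRing_twoStep_of_mem_range' u₂ hx'.symm hx'c hT₃c hT₃irr huT₂ c₂₅ h2 hυ₂ hυ₂' z ?_
      rw [range_liftChart]
      exact hi
    · -- over `D₊(x₃)`: isomorphic to `Γ₃`, regular there by the THREE-step at `[0:0:0:1]`
      refine isRegularLocalRing_twoStep_of_mem_open' u₂ hx'.symm hx'c hT₃c hT₃irr huT₂ c₂₅ h2 hυ₂ hυ₂' O₃ hp'O₃ hregO₃ z ?_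
      change ((υ' ≫ υᵢ) ≫ υ₁) _ ∈ Set.range (u3 k)
      rw [range_u3]
      exact hi
    · -- over `D₊(x₁) ∪ D₊(x₂)`: isomorphic to `Γ₀`, smooth charts
      refine isRegularLocalRing_twoStep_of_mem_open' u₂ hx'.symm hx'c hT₃c hT₃irr huT₂ c₂₅ h2 hυ₂ hυ₂' O₁₂' hp'O₁₂ hregO₁₂ z ?_
      change ((υ' ≫ υᵢ) ≫ υ₁) _ ∈ O₁₂
      rw [hmemO₁₂]
      rcases h12 with rfl | rfl
      · exact Or.inl hi
      · exact Or.inr hi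

end SpecimenQuarticTcPlus

end Summit.ResolutionOfSingularities.ResolutionOfSingularities.Cruxes.EquisingularLiftNat.Sections
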